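import Literature.Geometry.Lorentzian.BogovskiiKernelSecondOrder
import Mathlib.Analysis.Convolution
import HarnessLib

/-!
# The Bogovskiĭ-type operator of Mao–Oh–Tao's Lemma 2.3: (S1) and weak (S2)

(trunk G08 = T-LORENTZ; family `gr`; namespace `Literature.Geometry.Lorentzian.MaoOhTao`.)

Mao–Oh–Tao (arXiv:2308.13031), Lemma 2.3: on an open set `Ω ⊆ ℝ³` star-shaped with respect to a ball `B`, with
`η ∈ C^∞_c(B)`, `∫ η = 1`, the operator

  `(S f)^{ij}(x) = ∫ Ψ^{ij}_η(x, y) f(y) dy`,  `Ψ^{ij}_η(z + y, y) = (∫_{|z|}^∞ η(r z/|z| + y) r² dr) zⁱzʲ/|z|³`,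

satisfies (S1) `supp S f ⊆ Ω` when `supp f ⊆ Ω`, and (S2) `∂_i∂_j (S f)^{ij} = f` when `∫ f (1, x₁, x₂, x₃) dx = 0`.
With the kernel written through `bogovskiiWeight` (`BogovskiiDoubleDivergence.lean`), this file proves:

* `continuousOn_bogovskiiWeight_param`, `continuousOn_bogovskiiWeight_sub` — the weight is jointly continuous in the
  base point `y`, so `Ψ_η(x, y)` is continuous off the diagonal; `exists_abs_bogovskiiWeight_le_of_norm_le` — a bound
  uniform over `|y| ≤ Y`;
* `integrable_bogovskiiKernel_prod` — `(x, y) ↦ Ψ^{ij}_η(x, y) f(y) g(x)` is integrable on `ℝ³ × ℝ³` for continuous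
  compactly supported `f, g` (domination by the convolution integrand `W|f(y)| · M 𝟙_{B_D}(x − y)/|x − y|`, Mathlib's
  `Integrable.convolution_integrand`);
* `sum_sum_integral_bogovskiiOperator_mul_pd_pd_eq` — **(S2) in weak form**: for `η ∈ C¹_c`, `f ∈ C_c` with
  `∫ f = ∫ yᵢ f = 0` and every `ψ ∈ C²_c`, `Σ_{i,j} ∫ (S f)^{ij} ∂ⱼ∂ᵢψ dx = (∫ η) ∫ f ψ` (Fubini, then the second-order
  formula for `Ψ_η` and the moment conditions, `BogovskiiKernelSecondOrder.lean`);
* `support_bogovskiiOperator_subset` — **(S1)**: `supp (S f)^{ij} ⊆ Ω` for `supp f ⊆ Ω`, `supp η ⊆ B`, `Ω` star-shaped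
  with respect to every point of `B`.

Everything is proved; no definitions, no named facts.  Not treated: the vector operator `T` of Lemma 2.3 ((T1), (T2),
[IseOh]) and the pseudo-differential bounds (S3), (S4), (T3), (T4); the gluing of star-shaped pieces (proof of
Lemma 2.2) needs (S3).

## References

* Y. Mao, S.-J. Oh, T. Tao, arXiv:2308.13031 (2023), Lemma 2.3 and its proof (key `MaoOhTao2023`).
* M. E. Bogovskiĭ, Dokl. Akad. Nauk SSSR 248 (1979), 1037–1040.
-/

noncomputable section

open scoped RealInnerProductSpace Topology ContDiff
open Filter MeasureTheory Set Metric Function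
open Literature.Analysis.FluidPDE

namespace Literature.Geometry.Lorentzian

namespace MaoOhTao

/-- `|zᵢ| ≤ |z|` (a private copy of a FluidPDE helper). [folklore] -/
private theorem abs_apply_le_norm' (v : E3) (i : Fin 3) : |v i| ≤ ‖v‖ := by
  simpa using PiLp.norm_apply_le v i

/-! ### The kernel `Ψ^{ij}_η(x, y)` as a function of both variables -/

section Joint

variable {η : E3 → ℝ} {R : ℝ}

/-- A bound `|w_y(r, α)| ≤ W` uniform over `|y| ≤ Y`, all radii and all unit vectors. [folklore] -/
theorem exists_abs_bogovskiiWeight_le_of_norm_le (hη : Continuous η) (hR : ∀ z : E3, R < ‖z‖ → η z = 0)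
    (Y : ℝ) : ∃ W, ∀ (y : E3), ‖y‖ ≤ Y → ∀ (r : ℝ) (α : E3), ‖α‖ = 1 → |bogovskiiWeight η y r α| ≤ W := by
  obtain ⟨M, hM⟩ := hη.bounded_above_of_compact_support
    (HasCompactSupport.intro (isCompact_closedBall (0 : E3) R) fun z hz ↦ hR z (by
      rwa [mem_closedBall, dist_zero_right, not_le] at hz))
  have hM0 : 0 ≤ M := (norm_nonneg _).trans (hM 0)
  set T : ℝ := |R + Y| + 1 with hT
  have hT0 : 0 < T := by positivity
  refine ⟨2 * T * (M * T ^ 2), fun y hy r α hα ↦ ?_⟩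
  set q : ℝ → ℝ := fun s ↦ η (s • α + y) * s ^ 2 with hq
  have hqi : Integrable q := integrable_eta_line hη hR hα y
  have hbound : ∀ s, ‖q s‖ ≤ (Icc (-T) T).indicator (fun _ ↦ M * T ^ 2) s := by
    intro s
    by_cases hs : s ∈ Icc (-T) T
    · rw [indicator_of_mem hs, hq, Real.norm_eq_abs, abs_mul, abs_pow]
      have h1 : |η (s • α + y)| ≤ M := by rw [← Real.norm_eq_abs]; exact hM _
      have h2 : |s| ≤ T := abs_le.2 ⟨hs.1, hs.2⟩
      exact mul_le_mul h1 (pow_le_pow_left₀ (abs_nonneg s) h2 2) (by positivity) hM0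
    · rw [indicator_of_notMem hs]
      have hTs : T < |s| := by
        by_contra h
        exact hs (abs_le.1 (not_lt.1 h))
      have hs' : R + ‖y‖ < |s| := by linarith [le_abs_self (R + Y)]
      show ‖η (s • α + y) * s ^ 2‖ ≤ 0
      rw [Real.norm_eq_abs, eta_line_eq_zero hR hα hs', zero_mul, abs_zero]
  have hind : Integrable fun s : ℝ ↦ (Icc (-T) T).indicator (fun _ ↦ M * T ^ 2) s :=
    (integrable_indicator_iff measurableSet_Icc).2 (continuous_const.integrableOn_Icc)
  calc |bogovskiiWeight η y r α| = ‖∫ s in Ioi r, q s‖ := by rw [Real.norm_eq_abs]; rfl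
    _ ≤ ∫ s in Ioi r, ‖q s‖ := norm_integral_le_integral_norm _
    _ ≤ ∫ s, ‖q s‖ := setIntegral_le_integral hqi.norm (Eventually.of_forall fun s ↦ norm_nonneg _)
    _ ≤ ∫ s, (Icc (-T) T).indicator (fun _ ↦ M * T ^ 2) s := integral_mono hqi.norm hind hbound
    _ = 2 * T * (M * T ^ 2) := by
        rw [integral_indicator measurableSet_Icc, setIntegral_const, Real.volume_real_Icc_of_le (by linarith),
          smul_eq_mul]
        ring

/-- **Joint continuity of the weight in the base point**: `(y, r, α) ↦ w_y(r, α)` is continuous on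
`univ × univ × 𝕊²`. [folklore] -/
theorem continuousOn_bogovskiiWeight_param (hη : Continuous η) (hR : ∀ z : E3, R < ‖z‖ → η z = 0) :
    ContinuousOn (fun p : E3 × ℝ × E3 ↦ bogovskiiWeight η p.1 p.2.1 p.2.2)
      (univ ×ˢ (univ ×ˢ sphere (0 : E3) 1)) := by
  have hT : ∀ Y T : ℝ, ContinuousOn (fun p : E3 × ℝ × E3 ↦ bogovskiiWeight η p.1 p.2.1 p.2.2)
      (closedBall (0 : E3) Y ×ˢ (Icc (-T) T ×ˢ sphere (0 : E3) 1)) := by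
    intro Y T
    have hf : ContinuousOn (uncurry fun (p : E3 × ℝ × E3) (u : ℝ) ↦
        η ((u + p.2.1) • p.2.2 + p.1) * (u + p.2.1) ^ 2)
        ((closedBall (0 : E3) Y ×ˢ (Icc (-T) T ×ˢ sphere (0 : E3) 1)) ×ˢ univ) := by
      refine Continuous.continuousOn ?_
      have hr : Continuous fun q : (E3 × ℝ × E3) × ℝ ↦ q.2 + q.1.2.1 :=
        continuous_snd.add (continuous_fst.comp (continuous_snd.comp continuous_fst))
      refine (hη.comp ?_).mul (hr.pow 2)
      exact (hr.smul (continuous_snd.comp (continuous_snd.comp continuous_fst))).add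
        (continuous_fst.comp continuous_fst)
    have hk : IsCompact (Icc (-(R + Y + T)) (R + Y + T)) := isCompact_Icc
    have h := continuousOn_integral_of_compact_support (μ := (volume : Measure ℝ).restrict (Ioi 0)) hk hf
      (fun p u hp hu ↦ ?_)
    · refine h.congr fun p _ ↦ ?_
      exact bogovskiiWeight_eq_integral_Ioi_zero η p.1 p.2.1 p.2.2
    · have hy : ‖p.1‖ ≤ Y := by simpa [mem_closedBall, dist_zero_right] using hp.1
      have hα : ‖p.2.2‖ = 1 := by simpa using hp.2.2
      have hr : |p.2.1| ≤ T := abs_le.2 ⟨hp.2.1.1, hp.2.1.2⟩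
      have hu' : R + Y + T < |u| := by
        by_contra hcon
        exact hu (abs_le.1 (not_lt.1 hcon))
      have hs : R + ‖p.1‖ < |u + p.2.1| := by
        have h2 : |u| ≤ |u + p.2.1| + |p.2.1| := by
          calc |u| = |(u + p.2.1) - p.2.1| := by rw [add_sub_cancel_right]
            _ ≤ |u + p.2.1| + |p.2.1| := abs_sub _ _
        linarith
      show η ((u + p.2.1) • p.2.2 + p.1) * (u + p.2.1) ^ 2 = 0
      rw [eta_line_eq_zero hR hα hs, zero_mul]
  intro p hp
  set Y : ℝ := ‖p.1‖ + 1 with hYdef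
  set T : ℝ := |p.2.1| + 1 with hTdef
  have hmem : p ∈ closedBall (0 : E3) Y ×ˢ (Icc (-T) T ×ˢ sphere (0 : E3) 1) :=
    ⟨by rw [mem_closedBall, dist_zero_right]; linarith,
      ⟨by linarith [neg_abs_le p.2.1], by linarith [le_abs_self p.2.1]⟩, hp.2.2⟩
  refine ((hT Y T).continuousWithinAt hmem).mono_of_mem_nhdsWithin ?_
  refine mem_nhdsWithin.2 ⟨ball p.1 1 ×ˢ (Ioo (-T) T ×ˢ univ),
    isOpen_ball.prod (isOpen_Ioo.prod isOpen_univ),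
    ⟨mem_ball_self one_pos, ⟨by linarith [neg_abs_le p.2.1], by linarith [le_abs_self p.2.1]⟩, mem_univ _⟩, ?_⟩
  rintro q ⟨⟨hq1, hq2, -⟩, ⟨-, -, hq3⟩⟩
  refine ⟨?_, ⟨hq2.1.le, hq2.2.le⟩, hq3⟩
  rw [mem_closedBall, dist_zero_right]
  rw [mem_ball, dist_eq_norm] at hq1
  have := norm_le_insert' q.1 p.1  -- ‖q.1‖ ≤ ‖p.1‖ + ‖q.1 - p.1‖
  linarith

/-- **The kernel is continuous off the diagonal**: `(x, y) ↦ w_y(|x − y|, (x − y)/|x − y|)` is continuous on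
`{x ≠ y}`. [folklore] -/
theorem continuousOn_bogovskiiWeight_sub (hη : Continuous η) (hR : ∀ z : E3, R < ‖z‖ → η z = 0) :
    ContinuousOn (fun p : E3 × E3 ↦ bogovskiiWeight η p.2 ‖p.1 - p.2‖ (‖p.1 - p.2‖⁻¹ • (p.1 - p.2)))
      {p | p.1 ≠ p.2} := by
  have hsub : Continuous fun p : E3 × E3 ↦ p.1 - p.2 := continuous_fst.sub continuous_snd
  refine (continuousOn_bogovskiiWeight_param hη hR).comp
    (continuous_snd.continuousOn.prodMk ((continuous_norm.comp hsub).continuousOn.prodMk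
      (((continuousOn_inv₀.comp (continuous_norm.comp hsub).continuousOn fun p hp ↦ ?_)).smul
        hsub.continuousOn))) fun p hp ↦ ⟨mem_univ _, mem_univ _, ?_⟩
  · simpa [sub_eq_zero] using hp
  · have hz : p.1 - p.2 ≠ 0 := sub_ne_zero.2 hp
    show ‖p.1 - p.2‖⁻¹ • (p.1 - p.2) ∈ sphere (0 : E3) 1
    rw [mem_sphere_zero_iff_norm, norm_smul, norm_inv, norm_norm, inv_mul_cancel₀ (norm_ne_zero_iff.2 hz)]

end Joint

/-! ### The operator `(S f)^{ij}(x) = ∫ Ψ^{ij}_η(x, y) f(y) dy`: (S1) and weak (S2) -/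

section Operator

variable {η ψ : E3 → ℝ} {R : ℝ}

/-- The diagonal of `ℝ³ × ℝ³` is null for the product Lebesgue measure. [folklore] -/
theorem ae_fst_ne_snd : ∀ᵐ p : E3 × E3 ∂((volume : Measure E3).prod (volume : Measure E3)), p.1 ≠ p.2 := by
  have hS : MeasurableSet {p : E3 × E3 | p.1 ≠ p.2} :=
    (isOpen_ne_fun continuous_fst continuous_snd).measurableSet
  refine (Measure.ae_prod_mem_iff_ae_ae_mem hS).2 (ae_of_all _ fun x ↦ ?_)
  filter_upwards [(countable_singleton x).ae_notMem (volume : Measure E3)] with y hy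
  exact fun h ↦ hy (h ▸ rfl)

/-- **Integrability of the kernel integrand on `ℝ³ × ℝ³`.** For continuous compactly supported `f, g`, the function
`(x, y) ↦ Ψ^{ij}_η(x, y) f(y) g(x)` is integrable for the product measure: it is dominated by
`W |f(y)| · M 𝟙_{B_D}(x − y)/|x − y|`, a convolution integrand of two integrable functions
(`MeasureTheory.Integrable.convolution_integrand`). [folklore] -/
theorem integrable_bogovskiiKernel_prod (hη : Continuous η) (hR : ∀ z : E3, R < ‖z‖ → η z = 0) {f g : E3 → ℝ}
    (hf : Continuous f) (hfc : HasCompactSupport f) (hg : Continuous g) (hgc : HasCompactSupport g) (i j : Fin 3) :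
    Integrable (fun p : E3 × E3 ↦
      bogovskiiWeight η p.2 ‖p.1 - p.2‖ (‖p.1 - p.2‖⁻¹ • (p.1 - p.2)) *
        ((p.1 - p.2) i * ((p.1 - p.2) j * (‖p.1 - p.2‖ ^ 3)⁻¹)) * f p.2 * g p.1)
      ((volume : Measure E3).prod (volume : Measure E3)) := by
  obtain ⟨Rf, hRf⟩ := hfc.isCompact.isBounded.subset_closedBall 0
  obtain ⟨Rg, hRg⟩ := hgc.isCompact.isBounded.subset_closedBall 0
  obtain ⟨W, hW⟩ := exists_abs_bogovskiiWeight_le_of_norm_le hη hR Rf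
  obtain ⟨M, hM⟩ := hg.bounded_above_of_compact_support hgc
  have hM0 : 0 ≤ M := (norm_nonneg _).trans (hM 0)
  set D : ℝ := Rg + Rf with hD
  -- the dominating convolution integrand
  set F₁ : E3 → ℝ := fun y ↦ max W 0 * |f y| with hF₁
  set k : E3 → ℝ := fun z ↦ M * (closedBall (0 : E3) D).indicator (fun z ↦ ‖z‖⁻¹) z with hk
  have hF₁i : Integrable F₁ := (continuous_const.mul hf.abs).integrable_of_hasCompactSupport hfc.abs.mul_left
  have hki : Integrable k := by
    refine Integrable.const_mul ((integrable_indicator_iff measurableSet_closedBall).2 ?_) M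
    have h : IntegrableOn (fun z : E3 ↦ ‖z‖⁻¹) (ball (0 : E3) (D + 1)) :=
      integrableOn_ball_of_norm_le_rpow (by rw [finrank_euclideanSpace_fin]; norm_num) (C := 1) (α := 1)
        (by rw [finrank_euclideanSpace_fin]; norm_num)
        (Eventually.of_forall fun z ↦ by rw [Real.rpow_neg (norm_nonneg _), Real.rpow_one, one_mul, norm_inv, norm_norm])
        (continuous_norm.measurable.inv.aestronglyMeasurable)
    exact h.mono_set (closedBall_subset_ball (by linarith))
  have hdom := hF₁i.convolution_integrand (L := ContinuousLinearMap.mul ℝ ℝ) hki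
  -- measurability: continuity off the (null) diagonal
  have hcont : ContinuousOn (fun p : E3 × E3 ↦
      bogovskiiWeight η p.2 ‖p.1 - p.2‖ (‖p.1 - p.2‖⁻¹ • (p.1 - p.2)) *
        ((p.1 - p.2) i * ((p.1 - p.2) j * (‖p.1 - p.2‖ ^ 3)⁻¹)) * f p.2 * g p.1) {p | p.1 ≠ p.2} := by
    have hsub : Continuous fun p : E3 × E3 ↦ p.1 - p.2 := continuous_fst.sub continuous_snd
    refine (((continuousOn_bogovskiiWeight_sub hη hR).mul ?_).mul (hf.comp continuous_snd).continuousOn).mul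
      (hg.comp continuous_fst).continuousOn
    refine ((EuclideanSpace.proj (𝕜 := ℝ) i).continuous.comp hsub).continuousOn.mul
      (((EuclideanSpace.proj (𝕜 := ℝ) j).continuous.comp hsub).continuousOn.mul
        (ContinuousOn.inv₀ ((continuous_norm.comp hsub).pow 3).continuousOn fun p hp ↦ ?_))
    exact pow_ne_zero 3 (norm_ne_zero_iff.2 (sub_ne_zero.2 hp))
  have hmeas : AEStronglyMeasurable (fun p : E3 × E3 ↦
      bogovskiiWeight η p.2 ‖p.1 - p.2‖ (‖p.1 - p.2‖⁻¹ • (p.1 - p.2)) *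
        ((p.1 - p.2) i * ((p.1 - p.2) j * (‖p.1 - p.2‖ ^ 3)⁻¹)) * f p.2 * g p.1)
      ((volume : Measure E3).prod (volume : Measure E3)) := by
    have h := hcont.aestronglyMeasurable (μ := (volume : Measure E3).prod (volume : Measure E3))
      (isOpen_ne_fun continuous_fst continuous_snd).measurableSet
    rwa [Measure.restrict_eq_self_of_ae_mem (s := {p : E3 × E3 | p.1 ≠ p.2}) ae_fst_ne_snd] at h
  refine hdom.mono' hmeas (Eventually.of_forall fun p ↦ ?_)
  -- the pointwise bound
  simp only [ContinuousLinearMap.mul_apply', hF₁, hk, Real.norm_eq_abs]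
  have hRHS0 : ∀ z : E3, 0 ≤ max W 0 * |f p.2| * (M * (closedBall (0 : E3) D).indicator (fun z ↦ ‖z‖⁻¹) z) :=
    fun z ↦ mul_nonneg (mul_nonneg (le_max_right _ _) (abs_nonneg _))
      (mul_nonneg hM0 (indicator_nonneg (fun z _ ↦ inv_nonneg.2 (norm_nonneg z)) _))
  by_cases hfp : f p.2 = 0
  · have : |bogovskiiWeight η p.2 ‖p.1 - p.2‖ (‖p.1 - p.2‖⁻¹ • (p.1 - p.2)) *
        ((p.1 - p.2) i * ((p.1 - p.2) j * (‖p.1 - p.2‖ ^ 3)⁻¹)) * f p.2 * g p.1| = 0 := by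
      rw [hfp]; simp
    rw [this]
    simpa only [hfp, abs_zero, mul_zero, zero_mul] using hRHS0 (p.1 - p.2)
  by_cases hgp : g p.1 = 0
  · have : |bogovskiiWeight η p.2 ‖p.1 - p.2‖ (‖p.1 - p.2‖⁻¹ • (p.1 - p.2)) *
        ((p.1 - p.2) i * ((p.1 - p.2) j * (‖p.1 - p.2‖ ^ 3)⁻¹)) * f p.2 * g p.1| = 0 := by
      rw [hgp]; simp
    rw [this]
    exact hRHS0 (p.1 - p.2)
  have hy : ‖p.2‖ ≤ Rf := by
    have := hRf (subset_tsupport _ (mem_support.2 hfp))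
    rwa [mem_closedBall, dist_zero_right] at this
  have hx : ‖p.1‖ ≤ Rg := by
    have := hRg (subset_tsupport _ (mem_support.2 hgp))
    rwa [mem_closedBall, dist_zero_right] at this
  have hzD : p.1 - p.2 ∈ closedBall (0 : E3) D := by
    rw [mem_closedBall, dist_zero_right]
    exact (norm_sub_le _ _).trans (by linarith)
  rw [indicator_of_mem hzD]
  by_cases hz : p.1 - p.2 = 0
  · have : |bogovskiiWeight η p.2 ‖p.1 - p.2‖ (‖p.1 - p.2‖⁻¹ • (p.1 - p.2)) *
        ((p.1 - p.2) i * ((p.1 - p.2) j * (‖p.1 - p.2‖ ^ 3)⁻¹)) * f p.2 * g p.1| = 0 := by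
      rw [hz]; simp
    rw [this]
    exact mul_nonneg (mul_nonneg (le_max_right _ _) (abs_nonneg _)) (mul_nonneg hM0 (inv_nonneg.2 (norm_nonneg _)))
  have hn : 0 < ‖p.1 - p.2‖ := norm_pos_iff.2 hz
  have hw : |bogovskiiWeight η p.2 ‖p.1 - p.2‖ (‖p.1 - p.2‖⁻¹ • (p.1 - p.2))| ≤ max W 0 :=
    (hW p.2 hy _ _ (by rw [norm_smul, norm_inv, norm_norm, inv_mul_cancel₀ hn.ne'])).trans (le_max_left _ _)
  have hm : |(p.1 - p.2) i * ((p.1 - p.2) j * (‖p.1 - p.2‖ ^ 3)⁻¹)| ≤ ‖p.1 - p.2‖⁻¹ := by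
    rw [abs_mul, abs_mul, abs_inv, abs_pow, abs_norm]
    calc |(p.1 - p.2) i| * (|(p.1 - p.2) j| * (‖p.1 - p.2‖ ^ 3)⁻¹)
        ≤ ‖p.1 - p.2‖ * (‖p.1 - p.2‖ * (‖p.1 - p.2‖ ^ 3)⁻¹) :=
          mul_le_mul (abs_apply_le_norm' _ i) (mul_le_mul_of_nonneg_right (abs_apply_le_norm' _ j)
            (by positivity)) (by positivity) (norm_nonneg _)
      _ = ‖p.1 - p.2‖⁻¹ := by field_simp
  rw [abs_mul, abs_mul, abs_mul]
  calc |bogovskiiWeight η p.2 ‖p.1 - p.2‖ (‖p.1 - p.2‖⁻¹ • (p.1 - p.2))| *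
        |(p.1 - p.2) i * ((p.1 - p.2) j * (‖p.1 - p.2‖ ^ 3)⁻¹)| * |f p.2| * |g p.1|
      ≤ max W 0 * ‖p.1 - p.2‖⁻¹ * |f p.2| * M := by
        refine mul_le_mul (mul_le_mul (mul_le_mul hw hm (abs_nonneg _) (le_max_right _ _)) le_rfl
          (abs_nonneg _) (by positivity)) ?_ (abs_nonneg _) (by positivity)
        rw [← Real.norm_eq_abs]; exact hM _
    _ = max W 0 * |f p.2| * (M * ‖p.1 - p.2‖⁻¹) := by ring

/-- **Lemma 2.3, (S2) in weak form for the operator `S`.** Let `η ∈ C¹_c(ℝ³)` vanish off `B̄_R`, let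
`(S f)^{ij}(x) = ∫ Ψ^{ij}_η(x, y) f(y) dy` with `Ψ^{ij}_η(x, y) = w_y(|x − y|, (x − y)/|x − y|) (x − y)ᵢ(x − y)ⱼ/|x − y|³`,
and let `f` be continuous and compactly supported with `∫ f = 0` and `∫ yᵢ f(y) dy = 0`. Then for every
`ψ ∈ C²_c(ℝ³)`,
`Σ_{i,j} ∫ (S f)^{ij}(x) ∂ⱼ∂ᵢψ(x) dx = (∫ η) ∫ f ψ`,
i.e. `∂_i∂_j (S f)^{ij} = f` in `𝒟'(ℝ³)` when `∫ η = 1` (Fubini on `ℝ³ × ℝ³`, then the second-order formula for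
`Ψ_η` and the moment conditions, `integral_mul_sum_sum_integral_bogovskiiKernel_eq`).
[cite: MaoOhTao2023, Lemma 2.3 (S2)] -/
theorem sum_sum_integral_bogovskiiOperator_mul_pd_pd_eq (hη : ContDiff ℝ 1 η)
    (hR : ∀ z : E3, R < ‖z‖ → η z = 0) (hψ : ContDiff ℝ 2 ψ) (hψc : HasCompactSupport ψ) {f : E3 → ℝ}
    (hf : Continuous f) (hfc : HasCompactSupport f) (hf0 : ∫ y : E3, f y = 0)
    (hf1 : ∀ i : Fin 3, ∫ y : E3, y i * f y = 0) :
    ∑ i, ∑ j, ∫ x : E3, (∫ y : E3, bogovskiiWeight η y ‖x - y‖ (‖x - y‖⁻¹ • (x - y)) *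
        ((x - y) i * ((x - y) j * (‖x - y‖ ^ 3)⁻¹)) * f y) * pd j (pd i ψ) x =
      (∫ z : E3, η z) * ∫ y : E3, f y * ψ y := by
  have hηc : Continuous η := hη.continuous
  have hg : ∀ i j, Continuous (pd j (pd i ψ)) := fun i j ↦
    ((contDiff_pd (n := 1) hψ i).continuous_fderiv one_ne_zero).clm_apply continuous_const
  have hgc : ∀ i j, HasCompactSupport (pd j (pd i ψ)) := fun i j ↦
    hasCompactSupport_pd (hasCompactSupport_pd hψc i) j
  -- pointwise in `y`: `∫ Ψ(x, y) f(y) g(x) dx = f(y) ∫ Ψ(z + y, y) g(z + y) dz`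
  have hpt : ∀ i j (y : E3), ∫ x : E3, bogovskiiWeight η y ‖x - y‖ (‖x - y‖⁻¹ • (x - y)) *
      ((x - y) i * ((x - y) j * (‖x - y‖ ^ 3)⁻¹)) * f y * pd j (pd i ψ) x =
      f y * ∫ z : E3, bogovskiiWeight η y ‖z‖ (‖z‖⁻¹ • z) * (z i * (z j * (‖z‖ ^ 3)⁻¹)) *
        pd j (pd i ψ) (z + y) := by
    intro i j y
    rw [← integral_add_right_eq_self (μ := (volume : Measure E3)) _ y, ← integral_const_mul]
    refine integral_congr_ae (ae_of_all _ fun z ↦ ?_)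
    simp only [add_sub_cancel_right]
    ring
  have hint := fun i j ↦ integrable_bogovskiiKernel_prod hηc hR hf hfc (hg i j) (hgc i j) i j
  -- Fubini for each `(i, j)`
  have hij : ∀ i j, ∫ x : E3, (∫ y : E3, bogovskiiWeight η y ‖x - y‖ (‖x - y‖⁻¹ • (x - y)) *
      ((x - y) i * ((x - y) j * (‖x - y‖ ^ 3)⁻¹)) * f y) * pd j (pd i ψ) x =
      ∫ y : E3, f y * ∫ z : E3, bogovskiiWeight η y ‖z‖ (‖z‖⁻¹ • z) * (z i * (z j * (‖z‖ ^ 3)⁻¹)) *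
        pd j (pd i ψ) (z + y) := by
    intro i j
    calc ∫ x : E3, (∫ y : E3, bogovskiiWeight η y ‖x - y‖ (‖x - y‖⁻¹ • (x - y)) *
          ((x - y) i * ((x - y) j * (‖x - y‖ ^ 3)⁻¹)) * f y) * pd j (pd i ψ) x
        = ∫ x : E3, ∫ y : E3, bogovskiiWeight η y ‖x - y‖ (‖x - y‖⁻¹ • (x - y)) *
          ((x - y) i * ((x - y) j * (‖x - y‖ ^ 3)⁻¹)) * f y * pd j (pd i ψ) x :=
          integral_congr_ae (ae_of_all _ fun x ↦ (integral_mul_const _ _).symm)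
      _ = ∫ y : E3, ∫ x : E3, bogovskiiWeight η y ‖x - y‖ (‖x - y‖⁻¹ • (x - y)) *
          ((x - y) i * ((x - y) j * (‖x - y‖ ^ 3)⁻¹)) * f y * pd j (pd i ψ) x :=
          integral_integral_swap (hint i j)
      _ = _ := integral_congr_ae (ae_of_all _ fun y ↦ hpt i j y)
  -- integrability in `y` of the sections (Fubini)
  have hI : ∀ i j, Integrable fun y : E3 ↦ f y * ∫ z : E3,
      bogovskiiWeight η y ‖z‖ (‖z‖⁻¹ • z) * (z i * (z j * (‖z‖ ^ 3)⁻¹)) * pd j (pd i ψ) (z + y) := by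
    intro i j
    refine (Integrable.integral_prod_right (hint i j)).congr (ae_of_all _ fun y ↦ ?_)
    exact hpt i j y
  rw [Finset.sum_congr rfl fun i _ ↦ Finset.sum_congr rfl fun j _ ↦ hij i j,
    Finset.sum_congr rfl fun i _ ↦ (integral_finsetSum _ fun j _ ↦ hI i j).symm,
    ← integral_finsetSum _ fun i _ ↦ integrable_finsetSum _ fun j _ ↦ hI i j,
    ← integral_mul_sum_sum_integral_bogovskiiKernel_eq hη hR hψ hψc hf hfc hf0 hf1]
  refine integral_congr_ae (ae_of_all _ fun y ↦ ?_)
  simp only [Finset.mul_sum]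

/-- **Lemma 2.3, (S1) for the operator `S`.** If `Ω` is star-shaped with respect to every point of `B ⊇ supp η`
and `supp f ⊆ Ω`, then `(S f)^{ij}(x) = ∫ Ψ^{ij}_η(x, y) f(y) dy = 0` for `x ∉ Ω` (the integrand vanishes identically:
`Ψ(x, y) f(y) ≠ 0` forces `y ∈ Ω` and then `x = (x − y) + y ∈ Ω`). [cite: MaoOhTao2023, Lemma 2.3 (S1)] -/
theorem integral_bogovskiiKernel_mul_eq_zero_of_notMem {Ω B : Set E3} (hΩ : ∀ b ∈ B, StarConvex ℝ b Ω)
    (hηB : ∀ z, η z ≠ 0 → z ∈ B) {f : E3 → ℝ} (hfΩ : ∀ y, f y ≠ 0 → y ∈ Ω) {x : E3} (hx : x ∉ Ω)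
    (i j : Fin 3) :
    ∫ y : E3, bogovskiiWeight η y ‖x - y‖ (‖x - y‖⁻¹ • (x - y)) *
        ((x - y) i * ((x - y) j * (‖x - y‖ ^ 3)⁻¹)) * f y = 0 := by
  refine integral_eq_zero_of_ae (ae_of_all _ fun y ↦ ?_)
  by_contra h
  rcases mul_ne_zero_iff.1 h with ⟨hΨ, hfy⟩
  have := add_mem_of_bogovskiiKernel_ne_zero hΩ hηB (hfΩ y hfy) i j hΨ
  rw [sub_add_cancel] at this
  exact hx this

/-- (S1) in support form: `supp (S f)^{ij} ⊆ Ω`. [cite: MaoOhTao2023, Lemma 2.3 (S1)] -/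
theorem support_bogovskiiOperator_subset {Ω B : Set E3} (hΩ : ∀ b ∈ B, StarConvex ℝ b Ω)
    (hηB : ∀ z, η z ≠ 0 → z ∈ B) {f : E3 → ℝ} (hfΩ : ∀ y, f y ≠ 0 → y ∈ Ω) (i j : Fin 3) :
    support (fun x : E3 ↦ ∫ y : E3, bogovskiiWeight η y ‖x - y‖ (‖x - y‖⁻¹ • (x - y)) *
        ((x - y) i * ((x - y) j * (‖x - y‖ ^ 3)⁻¹)) * f y) ⊆ Ω := by
  intro x hx
  by_contra hxΩ
  exact hx (integral_bogovskiiKernel_mul_eq_zero_of_notMem hΩ hηB hfΩ hxΩ i j)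

end Operator

end MaoOhTao

end Literature.Geometry.Lorentzian

end
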